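import Literature.Analysis.FluidPDE.ClassicalSolutionCalculus
import HarnessLib

/-!
# Classical Navier–Stokes solutions: the pairing identity with pressure

Analysis/FluidPDE proof file (theorems only; no definitions, no named facts). For a classical
solution of the Navier–Stokes system on `S × E` and a compactly supported `C²` field `ψ`
(not assumed divergence-free):

* `IsClassicalNSSolutionOn.integral_inner_timeDerivWithin_test_pressure` — the slice identity
  `∫ ⟪∂ₜu, ψ⟫ = ∫ (⟪u, (u·∇)ψ⟫ + ν ⟪u, Δψ⟫ + ⟪f, ψ⟫) + ∫ p div ψ`
  (the tree's `integral_inner_timeDerivWithin_test` keeps the pressure term);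
* `IsClassicalNSSolutionOn.integral_inner_sub_eq_pressure` — its time-integrated form on
  `[0, T]`: `⟪u(t), ψ⟫ - ⟪u(s), ψ⟫ = ∫_s^t (∫ (⟪u, (u·∇)ψ⟫ + ν⟪u, Δψ⟫ + ⟪f, ψ⟫) + ∫ p div ψ)`
  (Leray 1934, (17); Temam, Ch. III §1.1, with the pressure kept).

Used (for the time modulus of blow-up sequences at a point of the final slice) on the discharge
path of `seregin_sverak_2002`.

## References

* J. Leray, Acta Math. 63 (1934), §III (17). [Leray1934]
* R. Temam, *Navier–Stokes equations*, Ch. III §1.1. [Temam1977]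
-/

noncomputable section

open MeasureTheory TopologicalSpace Set Function Filter Topology InnerProductSpace
open scoped RealInnerProductSpace ENNReal NNReal Laplacian ContDiff

namespace Literature.Analysis.FluidPDE

variable {E : Type*} [NormedAddCommGroup E] [InnerProductSpace ℝ E] [FiniteDimensional ℝ E]
  [MeasurableSpace E] [BorelSpace E]

variable {T ν : ℝ} {f u : ℝ → E → E} {p : ℝ → E → ℝ}

/-- **The slice identity with pressure.** For a classical solution on `S × E`, `t ∈ S`, and a
compactly supported `C²` field `ψ`:
`∫ ⟪∂ₜu(t), ψ⟫ = ∫ (⟪u, (u·∇)ψ⟫ + ν⟪u, Δψ⟫ + ⟪f, ψ⟫) + ∫ p(t) div ψ`. [cite: Leray1934, §III (17)] -/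
theorem IsClassicalNSSolutionOn.integral_inner_timeDerivWithin_test_pressure {S : Set ℝ}
    (h : IsClassicalNSSolutionOn S ν f u p) (hS : UniqueDiffOn ℝ S) {t : ℝ} (ht : t ∈ S)
    {ψt : E → E} (hψ : ContDiff ℝ 2 ψt) (hc : HasCompactSupport ψt) :
    ∫ x, ⟪timeDerivWithin S u t x, ψt x⟫ =
      (∫ x, (⟪u t x, convect (u t) ψt x⟫ + ν * ⟪u t x, (Δ ψt) x⟫ + ⟪f t x, ψt x⟫)) +
        ∫ x, p t x * VectorCalculus.divergence ψt x := by
  -- regularity of the slices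
  have hu2 : ContDiff ℝ 2 (u t) := contDiff_infty.1 (h.contDiff_velocity ht) 2
  have hu1 : ContDiff ℝ 1 (u t) := hu2.of_le one_le_two
  have hp1 : ContDiff ℝ 1 (p t) := contDiff_infty.1 (h.contDiff_pressure ht) 1
  have hψ1 : ContDiff ℝ 1 ψt := hψ.of_le one_le_two
  have huc : Continuous (u t) := hu1.continuous
  have hψc : Continuous ψt := hψ1.continuous
  have hdtc : Continuous (timeDerivWithin S u t) :=
    ((h.smooth_velocity.timeDerivWithin hS).contDiff_slice ht).continuous
  -- the force through the equation
  have hf_eq : ∀ x, f t x = timeDerivWithin S u t x + convect (u t) (u t) x - ν • (Δ (u t)) x +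
      gradient (p t) x := fun x => by
    have := h.momentum t ht x
    rw [eq_comm, ← sub_eq_zero] at this
    rw [← sub_eq_zero, ← this]
    abel
  have hfc : Continuous (f t) := h.continuous_force_slice hS ht
  -- integrability of every pairing with `ψt`
  have iC : Integrable (fun x => ⟪convect (u t) (u t) x, ψt x⟫) (volume : Measure E) :=
    integrable_inner_of_hasCompactSupport_right
      ((hu1.continuous_fderiv one_ne_zero).clm_apply huc) hψc hc
  have iL := integrable_inner_of_hasCompactSupport_right (continuous_laplacian hu2) hψc hc
  have iP := integrable_inner_of_hasCompactSupport_right (continuous_gradient_of_contDiff hp1)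
    hψc hc
  have iF := integrable_inner_of_hasCompactSupport_right hfc hψc hc
  have iC' : Integrable (fun x => ⟪u t x, convect (u t) ψt x⟫) (volume : Measure E) :=
    integrable_inner_of_hasCompactSupport_right huc
      ((hψ1.continuous_fderiv one_ne_zero).clm_apply huc)
      ((hc.fderiv (𝕜 := ℝ)).mono fun x hx => by
        contrapose! hx; simp only [mem_support, not_not] at hx; simp [convect, hx])
  have iL' : Integrable (fun x => ⟪u t x, (Δ ψt) x⟫) (volume : Measure E) :=
    integrable_inner_of_hasCompactSupport_right huc (continuous_laplacian hψ)
      (hc.mono' fun x hx => by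
        contrapose! hx; simp [laplacian_eq_zero_of_notMem_tsupport hx])
  -- integration by parts, term by term
  have eC : ∫ x, ⟪convect (u t) (u t) x, ψt x⟫ = -∫ x, ⟪u t x, convect (u t) ψt x⟫ := by
    have h0 := integral_inner_convect_add_eq_zero hu1 hu1 hψ1 hc
    have hz : ∫ x, VectorCalculus.divergence (u t) x * ⟪u t x, ψt x⟫ = 0 := by
      simp [h.divFree t ht _]
    linarith
  have eL : ∫ x, ⟪(Δ (u t)) x, ψt x⟫ = ∫ x, ⟪u t x, (Δ ψt) x⟫ :=
    integral_inner_laplacian_comm hu2 hψ hc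
  have eP : ∫ x, ⟪gradient (p t) x, ψt x⟫ = -∫ x, p t x * VectorCalculus.divergence ψt x :=
    integral_inner_gradient_eq_neg_integral_mul_divergence hp1 hψ1 hc
  -- assemble
  have key : ∀ x, ⟪timeDerivWithin S u t x, ψt x⟫ = ⟪f t x, ψt x⟫ -
      ⟪convect (u t) (u t) x, ψt x⟫ + ν * ⟪(Δ (u t)) x, ψt x⟫ - ⟪gradient (p t) x, ψt x⟫ := by
    intro x
    rw [hf_eq x]
    simp only [inner_add_left, inner_sub_left, inner_smul_left, RCLike.conj_to_real]
    ring
  have j1 : Integrable (fun x => ⟪f t x, ψt x⟫ - ⟪convect (u t) (u t) x, ψt x⟫)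
      (volume : Measure E) := iF.sub iC
  have j2 : Integrable (fun x => ν * ⟪(Δ (u t)) x, ψt x⟫) (volume : Measure E) := iL.const_mul ν
  have j3 : Integrable (fun x => ⟪f t x, ψt x⟫ - ⟪convect (u t) (u t) x, ψt x⟫ +
      ν * ⟪(Δ (u t)) x, ψt x⟫) (volume : Measure E) := j1.add j2
  have j4 : Integrable (fun x => ν * ⟪u t x, (Δ ψt) x⟫) (volume : Measure E) := iL'.const_mul ν
  have j5 : Integrable (fun x => ⟪u t x, convect (u t) ψt x⟫ + ν * ⟪u t x, (Δ ψt) x⟫)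
      (volume : Measure E) := iC'.add j4
  rw [integral_congr_ae (Eventually.of_forall key), integral_sub j3 iP, integral_add j1 j2,
    integral_sub iF iC, integral_const_mul, integral_add j5 iF, integral_add iC' j4,
    integral_const_mul, eC, eL, eP]
  ring

/-- **The pairing identity with pressure, integrated in time.** For a classical solution on
`[0, T] × E` (`T > 0`), a compactly supported `C²` field `ψ` and `0 ≤ s ≤ t ≤ T`:
`⟪u(t), ψ⟫ - ⟪u(s), ψ⟫ = ∫_s^t (∫ (⟪u, (u·∇)ψ⟫ + ν⟪u, Δψ⟫ + ⟪f, ψ⟫) + ∫ p div ψ) dτ`.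
[cite: Leray1934, §III (17); Temam1977, Ch. III §1.1] -/
theorem IsClassicalNSSolutionOn.integral_inner_sub_eq_pressure
    (h : IsClassicalNSSolutionOn (Icc 0 T) ν f u p) (hT : 0 < T)
    {ψt : E → E} (hψ : ContDiff ℝ 2 ψt) (hc : HasCompactSupport ψt)
    {s t : ℝ} (hs : 0 ≤ s) (hst : s ≤ t) (ht : t ≤ T) :
    (∫ x, ⟪u t x, ψt x⟫) - ∫ x, ⟪u s x, ψt x⟫ =
      ∫ τ in s..t, ((∫ x, (⟪u τ x, convect (u τ) ψt x⟫ + ν * ⟪u τ x, (Δ ψt) x⟫ + ⟪f τ x, ψt x⟫)) +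
        ∫ x, p τ x * VectorCalculus.divergence ψt x) := by
  have hU : UniqueDiffOn ℝ (Icc 0 T) := uniqueDiffOn_Icc hT
  have hu_cont : ContinuousOn (uncurry u) (Icc 0 T ×ˢ univ) := h.smooth_velocity.continuousOn
  have hdt_cont : ContinuousOn (uncurry (timeDerivWithin (Icc 0 T) u)) (Icc 0 T ×ˢ univ) :=
    (h.smooth_velocity.timeDerivWithin hU).continuousOn
  have hψc : Continuous ψt := hψ.continuous
  set K : Set E := tsupport ψt with hK
  have hKc : IsCompact K := hc
  have hψK : ∀ x ∉ K, ψt x = 0 := fun x hx => image_eq_zero_of_notMem_tsupport hx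
  have hsub : Icc s t ×ˢ (univ : Set E) ⊆ Icc 0 T ×ˢ univ := prod_mono (Icc_subset_Icc hs ht) Subset.rfl
  -- the integrand `G = ⟪∂ₜu, ψ⟫` and its integrability on `(s, t) × E`
  set G : ℝ × E → ℝ := fun z => ⟪timeDerivWithin (Icc 0 T) u z.1 z.2, ψt z.2⟫ with hG
  have hGcont : ContinuousOn G (Icc s t ×ˢ univ) :=
    (hdt_cont.mono hsub).inner (hψc.comp continuous_snd).continuousOn
  have hGK : ∀ τ ∈ Icc s t, ∀ x ∉ K, G (τ, x) = 0 := fun τ _ x hx => by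
    simp only [hG, hψK x hx, inner_zero_right]
  have hGint := integrable_prod_of_continuousOn hKc hGcont hGK
  -- the fundamental theorem of calculus on each time line
  have htI : t ∈ Icc 0 T := ⟨hs.trans hst, ht⟩
  have hsI : s ∈ Icc 0 T := ⟨hs, hst.trans ht⟩
  have hline : ∀ x, ∫ τ in Ioo s t, G (τ, x) = ⟪u t x, ψt x⟫ - ⟪u s x, ψt x⟫ := by
    intro x
    rcases eq_or_lt_of_le hst with rfl | hst'
    · simp
    have hcont : ContinuousOn (fun τ => ⟪u τ x, ψt x⟫) (Icc s t) :=
      (hu_cont.comp (Continuous.prodMk_left x).continuousOn fun τ hτ =>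
        mk_mem_prod (Icc_subset_Icc hs ht hτ) (mem_univ x)).inner continuousOn_const
    have hderiv : ∀ τ ∈ Ioo s t, HasDerivWithinAt (fun τ => ⟪u τ x, ψt x⟫) (G (τ, x)) (Ioi τ) τ := by
      intro τ hτ
      have hτ0 : τ ∈ Ioo 0 T := ⟨hs.trans_lt hτ.1, hτ.2.trans_le ht⟩
      have hu' : HasDerivAt (fun σ => u σ x) (timeDerivWithin (Icc 0 T) u τ x) τ :=
        (h.smooth_velocity.hasDerivWithinAt_timeDerivWithin hU (Ioo_subset_Icc_self hτ0) x).hasDerivAt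
          (Icc_mem_nhds hτ0.1 hτ0.2)
      have hψ' : HasDerivAt (fun _ : ℝ => ψt x) 0 τ := hasDerivAt_const τ (ψt x)
      have h2 := (hu'.inner ℝ hψ').hasDerivWithinAt (s := Ioi τ)
      refine h2.congr_deriv ?_
      simp only [hG, inner_zero_right, zero_add]
    have hint : IntervalIntegrable (fun τ => G (τ, x)) volume s t := by
      refine ContinuousOn.intervalIntegrable ?_
      rw [uIcc_of_le hst]
      exact hGcont.comp (Continuous.prodMk_left x).continuousOn fun τ hτ => mk_mem_prod hτ (mem_univ x)
    have := intervalIntegral.integral_eq_sub_of_hasDeriv_right_of_le hst hcont hderiv hint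
    rw [intervalIntegral.integral_of_le hst, integral_Ioc_eq_integral_Ioo] at this
    rw [this]
  -- integrate over `x` and swap
  have hslice : ∀ {r : ℝ}, r ∈ Icc 0 T → Integrable (fun x => ⟪u r x, ψt x⟫) (volume : Measure E) :=
    fun {r} hr => integrable_inner_of_hasCompactSupport_right (h.contDiff_velocity hr).continuous hψc hc
  have hLHS : (∫ x, ⟪u t x, ψt x⟫) - ∫ x, ⟪u s x, ψt x⟫ = ∫ τ in Ioo s t, ∫ x, G (τ, x) := by
    rw [← integral_sub (hslice htI) (hslice hsI), integral_integral_swap (f := fun τ x => G (τ, x)) hGint]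
    exact integral_congr_ae (Eventually.of_forall fun x => (hline x).symm)
  rw [hLHS, intervalIntegral.integral_of_le hst, integral_Ioc_eq_integral_Ioo]
  -- the slice identity, for `τ ∈ (s, t)`
  refine setIntegral_congr_fun measurableSet_Ioo fun τ hτ => ?_
  have hτI : τ ∈ Icc 0 T := ⟨hs.trans hτ.1.le, hτ.2.le.trans ht⟩
  exact h.integral_inner_timeDerivWithin_test_pressure hU hτI hψ hc

end Literature.Analysis.FluidPDE

end
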